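import Summits.Ventures.CertifiedManyBodySolver.HubbardAlg.ThreeScalePencil
import Literature.MathematicalPhysics.QuantumLattice.FinDimSpectrumClusterGapProofs
import HarnessLib

/-!
# ThreeScalePencilSpectrum — the Courant–Fischer reading of `ThreeScalePencil`: eigenvalue COUNTS of the
preconditioned three-scale Schur pencil (hubbard-algo crew (5), D-0042 R2(e); companion of
`HubbardAlg/ThreeScalePencil.lean`, whose module docstring states this reading as "informal, NOT formalised")

HONEST FRAMING: solver-side finite-dimensional linear algebra; this file has NO number and NO bound on any Hubbard
quantity; it turns the three quadratic-form clauses of `KryIpm.ThreeScalePencil` into statements about how many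
eigenvalues of the preconditioned matrix lie where — the quantity that governs (deflated) PCG iteration counts in the
cell's KRY-IPM letters (p1 TARGET.md §0e/§1 Thm M: "all but `dim T_F` generalized eigenvalues of the pencil
`(H(μ), P(μ))` lie in `[c, C]` and the remaining `dim T_F` are `O(μ)` — i.e. STRUCT-1 is μ-uniform iff `T_F = 0` and
STRUCT-2 (STRUCT-1 + exact deflation of `T_F`) is μ-uniform always").

Setting. `H = Hmu Hm H0 Hp μ`, `P = Pmu Hm σ μ` (from `ThreeScalePencil.lean`), `R` any matrix with `Rᴴ P R = 1`
(a `P`-orthonormal basis, e.g. `R = P^{-1/2}` or the inverse Cholesky factor; it exists because `P ≻ 0` for `σ > 0` —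
not constructed here, the statements quantify over every such `R`). The generalized eigenvalues of the pencil
`(H, P)` are the eigenvalues of the real symmetric matrix `K = Rᴴ H R` (`precond`), and `T_F = ker H₋ ∩ ker H₀`
(`faceSubmodule`, the `Submodule` form of `KryIpm.faceSpace`), `k = dim T_F`.

PROVED (for `n : ℕ`, all matrices real `Fin n × Fin n`, `H₋ H₀ H₊ ⪰ 0`, `0 < σ`, `0 < μ`):
* `eigenvalues_precond_le` — clause (1) with constant `C` ⟹ EVERY eigenvalue of `K` is `≤ C`;
* `finrank_faceSubmodule_le_card_eigenvalues_le` — clause (3) with constant `C₃` ⟹ at least `k` eigenvalues of `K` are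
  `≤ C₃ μ / σ` (the face directions, transported by `R⁻¹`, form a `k`-dimensional subspace on which
  `vᵀKv ≤ (C₃μ/σ)‖v‖²`, because `P ⪰ σ·1`);
* `sub_finrank_faceSubmodule_le_card_le_eigenvalues` — clause (2) with constant `c` ⟹ at least `n − k` eigenvalues of
  `K` are `≥ c`;
* `threeScalePencil_spectrum` — all three from `KryIpm.threeScalePencil_holds`: μ-free `c, C > 0`, `C₃ ≥ 0` such that
  for every `μ ∈ (0, μ₀]` and every `P(μ)`-orthonormal `R`: all eigenvalues `≤ C`, `≥ n − k` of them `≥ c`, `≥ k` of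
  them `≤ C₃μ/σ`; and `threeScalePencil_spectrum_exact` — once `C₃ μ / σ < c` the two groups are complementary:
  EXACTLY `k` eigenvalues `≤ C₃μ/σ` and EXACTLY `n − k` eigenvalues `≥ c` (so after exact deflation of the `k` face
  directions the remaining spectrum sits in `[c, C]`, uniformly in `μ`).
Tools: the variational counting lemmas (Courant–Fischer in counting form)
`Literature.MathematicalPhysics.QuantumLattice.finrank_le_card_eigenvalues_le` / `finrank_le_card_le_eigenvalues`
[Reed–Simon IV Thm XIII.1; Bhatia Cor. III.1.2], Mathlib's `Submodule.finrank_add_finrank_orthogonal`.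
Scope (honest): exact arithmetic statements about eigenvalue counts; nothing about PCG iteration numbers themselves
(that step is the classical CG polynomial bound, not formalised here), nothing about the SIZE of `c` (measured by the
cell: KRY letters), nothing off the central path.
-/

noncomputable section
namespace Summit.Ventures.CertifiedManyBodySolver.HubbardAlg.KryIpm
open Matrix Finset Module WithLp
open scoped InnerProductSpace
open Literature.MathematicalPhysics.QuantumLattice

variable {n : ℕ}

/-! ### Bridge between the `dotProduct` world of `ThreeScalePencil.lean` and `EuclideanSpace ℝ (Fin n)` -/

/-- `re ⟪x, K x⟫ = qf K x` on `EuclideanSpace ℝ (Fin n)`. [folklore] -/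
theorem re_inner_toEuclideanLin (K : Matrix (Fin n) (Fin n) ℝ) (x : EuclideanSpace ℝ (Fin n)) :
    RCLike.re ⟪x, toEuclideanLin K x⟫_ℝ = qf K (ofLp x) := by
  rw [EuclideanSpace.inner_eq_star_dotProduct, star_trivial, RCLike.re_to_real, qf, dotProduct_comm]
  rfl

/-- `‖x‖² = x ⬝ᵥ x` on `EuclideanSpace ℝ (Fin n)`. [folklore] -/
theorem norm_sq_eq_dotProduct (x : EuclideanSpace ℝ (Fin n)) : ‖x‖ ^ 2 = ofLp x ⬝ᵥ ofLp x := by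
  rw [← real_inner_self_eq_norm_sq, EuclideanSpace.inner_eq_star_dotProduct, star_trivial]

/-- Congruence moves into the argument of the form: `qf (Rᴴ A R) v = qf A (R v)`. [folklore] -/
theorem qf_conjTranspose_mul_mul (R A : Matrix (Fin n) (Fin n) ℝ) (v : Fin n → ℝ) :
    qf (Rᴴ * A * R) v = qf A (R *ᵥ v) := by
  rw [qf, qf, conjTranspose_eq_transpose_of_trivial, ← mulVec_mulVec, ← mulVec_mulVec, dotProduct_mulVec,
    vecMul_transpose]

/-! ### The objects: preconditioned matrix, face submodule -/

/-- The preconditioned matrix `K = Rᴴ H(μ) R` whose eigenvalues are the generalized eigenvalues of the pencil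
`(H(μ), P(μ))` when `Rᴴ P(μ) R = 1`. [folklore] -/
def precond (Hm H0 Hp R : Matrix (Fin n) (Fin n) ℝ) (μ : ℝ) : Matrix (Fin n) (Fin n) ℝ :=
  Rᴴ * Hmu Hm H0 Hp μ * R

/-- `H(μ) = μ⁻¹H₋ + H₀ + μH₊` is positive semidefinite for `μ > 0`. [folklore] -/
theorem posSemidef_Hmu {Hm H0 Hp : Matrix (Fin n) (Fin n) ℝ} (hm : Hm.PosSemidef) (h0 : H0.PosSemidef)
    (hp : Hp.PosSemidef) {μ : ℝ} (hμ : 0 < μ) : (Hmu Hm H0 Hp μ).PosSemidef :=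
  ((hm.smul (inv_nonneg.mpr hμ.le)).add h0).add (hp.smul hμ.le)

/-- `K` is symmetric. [folklore] -/
theorem isHermitian_precond {Hm H0 Hp : Matrix (Fin n) (Fin n) ℝ} (hm : Hm.PosSemidef) (h0 : H0.PosSemidef)
    (hp : Hp.PosSemidef) (R : Matrix (Fin n) (Fin n) ℝ) {μ : ℝ} (hμ : 0 < μ) :
    (precond Hm H0 Hp R μ).IsHermitian :=
  isHermitian_conjTranspose_mul_mul R (posSemidef_Hmu hm h0 hp hμ).1

/-- The face space `T_F = ker H₋ ∩ ker H₀` as a submodule of `EuclideanSpace ℝ (Fin n)`. [folklore] -/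
def faceSubmodule (Hm H0 : Matrix (Fin n) (Fin n) ℝ) : Submodule ℝ (EuclideanSpace ℝ (Fin n)) :=
  LinearMap.ker (toEuclideanLin Hm) ⊓ LinearMap.ker (toEuclideanLin H0)

/-- Membership: `x ∈ T_F` iff `ofLp x ∈ faceSpace`. [folklore] -/
theorem mem_faceSubmodule_iff (Hm H0 : Matrix (Fin n) (Fin n) ℝ) (x : EuclideanSpace ℝ (Fin n)) :
    x ∈ faceSubmodule Hm H0 ↔ ofLp x ∈ faceSpace Hm H0 := by
  simp only [faceSubmodule, Submodule.mem_inf, LinearMap.mem_ker, faceSpace, Set.mem_setOf_eq]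
  constructor
  · rintro ⟨h1, h2⟩
    exact ⟨by simpa using congrArg ofLp h1, by simpa using congrArg ofLp h2⟩
  · rintro ⟨h1, h2⟩
    refine ⟨?_, ?_⟩
    · apply (WithLp.ofLp_injective (p := 2))
      simpa using h1
    · apply (WithLp.ofLp_injective (p := 2))
      simpa using h2

/-- A vector Euclidean-orthogonal to `T_F` in `EuclideanSpace ℝ (Fin n)` is `dotProduct`-orthogonal to every
element of `faceSpace`. [folklore] -/
theorem dotProduct_eq_zero_of_mem_orthogonal {Hm H0 : Matrix (Fin n) (Fin n) ℝ} {y : EuclideanSpace ℝ (Fin n)}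
    (hy : y ∈ (faceSubmodule Hm H0)ᗮ) (w : Fin n → ℝ) (hw : w ∈ faceSpace Hm H0) : ofLp y ⬝ᵥ w = 0 := by
  have hmem : toLp 2 w ∈ faceSubmodule Hm H0 := (mem_faceSubmodule_iff Hm H0 _).mpr (by simpa using hw)
  have h := (Submodule.mem_orthogonal _ _).mp hy _ hmem
  rw [EuclideanSpace.inner_eq_star_dotProduct, star_trivial] at h
  simpa [dotProduct_comm] using h

/-! ### `R` with `Rᴴ P R = 1`: isometry identities and invertibility -/

section precondR

variable {Hm H0 Hp R : Matrix (Fin n) (Fin n) ℝ} {σ μ : ℝ}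

/-- With `Rᴴ P R = 1`: `‖v‖² = qf P (R v)`. [folklore] -/
theorem dotProduct_self_eq_qf_Pmu (hR : Rᴴ * Pmu Hm σ μ * R = 1) (v : Fin n → ℝ) :
    v ⬝ᵥ v = qf (Pmu Hm σ μ) (R *ᵥ v) := by
  rw [← qf_conjTranspose_mul_mul, hR, qf, one_mulVec]

/-- With `Rᴴ P R = 1`, `R` is injective (as `toEuclideanLin R`). [folklore] -/
theorem injective_toEuclideanLin (hR : Rᴴ * Pmu Hm σ μ * R = 1) : Function.Injective (toEuclideanLin R) := by
  intro x y hxy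
  have h0 : R *ᵥ (ofLp x - ofLp y) = 0 := by
    rw [mulVec_sub, sub_eq_zero]
    simpa using congrArg ofLp hxy
  have h1 : (ofLp x - ofLp y) ⬝ᵥ (ofLp x - ofLp y) = 0 := by
    rw [dotProduct_self_eq_qf_Pmu hR, h0, qf, mulVec_zero, dotProduct_zero]
  have h2 : ofLp x - ofLp y = 0 := dotProduct_self_eq_zero.mp h1
  exact WithLp.ofLp_injective (p := 2) (sub_eq_zero.mp h2)

end precondR

/-! ### Eigenvalue counts of the preconditioned matrix -/

section Counting

variable {Hm H0 Hp R : Matrix (Fin n) (Fin n) ℝ} {σ μ : ℝ}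

/-- The quadratic form of `K = Rᴴ H R` at `x` is the pencil numerator at `w = R x`, and `‖x‖²` is the pencil
denominator at `w` (when `Rᴴ P R = 1`). [folklore] -/
theorem re_inner_precond (hR : Rᴴ * Pmu Hm σ μ * R = 1) (x : EuclideanSpace ℝ (Fin n)) :
    RCLike.re ⟪x, toEuclideanLin (precond Hm H0 Hp R μ) x⟫_ℝ = qf (Hmu Hm H0 Hp μ) (R *ᵥ ofLp x) ∧
      ‖x‖ ^ 2 = qf (Pmu Hm σ μ) (R *ᵥ ofLp x) := by
  refine ⟨?_, ?_⟩
  · rw [re_inner_toEuclideanLin, precond, qf_conjTranspose_mul_mul]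
  · rw [norm_sq_eq_dotProduct, dotProduct_self_eq_qf_Pmu hR]

/-- **Clause (1) ⟹ every eigenvalue of the preconditioned matrix is `≤ C`.** [folklore] -/
theorem eigenvalues_precond_le (hm : Hm.PosSemidef) (h0 : H0.PosSemidef) (hp : Hp.PosSemidef)
    (hμ : 0 < μ) (hR : Rᴴ * Pmu Hm σ μ * R = 1) {C : ℝ}
    (h1 : ∀ v, qf (Hmu Hm H0 Hp μ) v ≤ C * qf (Pmu Hm σ μ) v) (i : Fin n) :
    (isHermitian_precond hm h0 hp R hμ).eigenvalues i ≤ C := by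
  have hform : ∀ x ∈ (⊤ : Submodule ℝ (EuclideanSpace ℝ (Fin n))),
      RCLike.re ⟪x, toEuclideanLin (precond Hm H0 Hp R μ) x⟫_ℝ ≤ C * ‖x‖ ^ 2 := by
    intro x _
    obtain ⟨ha, hb⟩ := re_inner_precond (H0 := H0) (Hp := Hp) hR x
    rw [ha, hb]
    exact h1 _
  have hcount := finrank_le_card_eigenvalues_le (isHermitian_precond hm h0 hp R hμ) ⊤ hform
  rw [finrank_top, finrank_euclideanSpace_fin] at hcount
  have huniv : (univ.filter fun j => (isHermitian_precond hm h0 hp R hμ).eigenvalues j ≤ C) = univ :=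
    Finset.eq_univ_of_card _ (le_antisymm (card_le_univ _) (by simpa using hcount))
  have hi : i ∈ (univ.filter fun j => (isHermitian_precond hm h0 hp R hμ).eigenvalues j ≤ C) := by
    rw [huniv]; exact mem_univ i
  exact (mem_filter.mp hi).2

/-- **Clause (3) ⟹ at least `dim T_F` eigenvalues are `≤ C₃ μ / σ`** (on the transported face `R⁻¹ T_F`,
a subspace of dimension `dim T_F`, the form of `K` is `≤ (C₃μ/σ)‖x‖²` since `P ⪰ σ·1`). [folklore] -/
theorem finrank_faceSubmodule_le_card_eigenvalues_le (hm : Hm.PosSemidef) (h0 : H0.PosSemidef)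
    (hp : Hp.PosSemidef) (hσ : 0 < σ) (hμ : 0 < μ) (hR : Rᴴ * Pmu Hm σ μ * R = 1) {C₃ : ℝ}
    (h3 : ∀ v ∈ faceSpace Hm H0, qf (Hmu Hm H0 Hp μ) v ≤ C₃ * μ * (v ⬝ᵥ v)) (hC₃ : 0 ≤ C₃) :
    finrank ℝ (faceSubmodule Hm H0) ≤
      (univ.filter fun j => (isHermitian_precond hm h0 hp R hμ).eigenvalues j ≤ C₃ * μ / σ).card := by
  set e : EuclideanSpace ℝ (Fin n) ≃ₗ[ℝ] EuclideanSpace ℝ (Fin n) :=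
    LinearEquiv.ofInjectiveEndo (toEuclideanLin R) (injective_toEuclideanLin hR) with he
  -- the transported face
  set V : Submodule ℝ (EuclideanSpace ℝ (Fin n)) := (faceSubmodule Hm H0).comap (e : _ →ₗ[ℝ] _) with hV
  have hfin : finrank ℝ V = finrank ℝ (faceSubmodule Hm H0) := by
    rw [hV, Submodule.comap_equiv_eq_map_symm, LinearEquiv.finrank_map_eq]
  have hform : ∀ x ∈ V, RCLike.re ⟪x, toEuclideanLin (precond Hm H0 Hp R μ) x⟫_ℝ ≤ C₃ * μ / σ * ‖x‖ ^ 2 := by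
    intro x hx
    have hRx : R *ᵥ ofLp x ∈ faceSpace Hm H0 := by
      have : e x ∈ faceSubmodule Hm H0 := hx
      rw [mem_faceSubmodule_iff] at this
      simpa [he] using this
    obtain ⟨ha, hb⟩ := re_inner_precond (H0 := H0) (Hp := Hp) hR x
    rw [ha, hb, qf_Pmu_expand]
    have hw := h3 _ hRx
    have hww : 0 ≤ (R *ᵥ ofLp x) ⬝ᵥ (R *ᵥ ofLp x) := Finset.sum_nonneg fun k _ => mul_self_nonneg _
    have hmw : 0 ≤ μ⁻¹ * qf Hm (R *ᵥ ofLp x) :=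
      mul_nonneg (inv_nonneg.mpr hμ.le) (qf_nonneg_of_posSemidef hm _)
    -- C₃ μ ‖w‖² ≤ (C₃ μ/σ) (σ‖w‖² + μ⁻¹ wᵀH₋w)
    have key : C₃ * μ * ((R *ᵥ ofLp x) ⬝ᵥ (R *ᵥ ofLp x)) ≤
        C₃ * μ / σ * (σ * ((R *ᵥ ofLp x) ⬝ᵥ (R *ᵥ ofLp x)) + μ⁻¹ * qf Hm (R *ᵥ ofLp x)) := by
      rw [mul_add, show C₃ * μ / σ * (σ * ((R *ᵥ ofLp x) ⬝ᵥ (R *ᵥ ofLp x)))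
        = C₃ * μ * ((R *ᵥ ofLp x) ⬝ᵥ (R *ᵥ ofLp x)) by field_simp]
      have : 0 ≤ C₃ * μ / σ * (μ⁻¹ * qf Hm (R *ᵥ ofLp x)) :=
        mul_nonneg (div_nonneg (mul_nonneg hC₃ hμ.le) hσ.le) hmw
      linarith
    exact hw.trans key
  have hcount := finrank_le_card_eigenvalues_le (isHermitian_precond hm h0 hp R hμ) V hform
  rwa [hfin] at hcount

/-- **Clause (2) ⟹ at least `n − dim T_F` eigenvalues are `≥ c`** (on `R⁻¹(T_Fᗮ)`, of dimension `n − dim T_F`,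
the form of `K` is `≥ c‖x‖²`). [folklore] -/
theorem sub_finrank_faceSubmodule_le_card_le_eigenvalues (hm : Hm.PosSemidef) (h0 : H0.PosSemidef)
    (hp : Hp.PosSemidef) (hμ : 0 < μ) (hR : Rᴴ * Pmu Hm σ μ * R = 1) {c : ℝ}
    (h2 : ∀ v, (∀ w ∈ faceSpace Hm H0, v ⬝ᵥ w = 0) → c * qf (Pmu Hm σ μ) v ≤ qf (Hmu Hm H0 Hp μ) v) :
    n - finrank ℝ (faceSubmodule Hm H0) ≤
      (univ.filter fun j => c ≤ (isHermitian_precond hm h0 hp R hμ).eigenvalues j).card := by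
  set e : EuclideanSpace ℝ (Fin n) ≃ₗ[ℝ] EuclideanSpace ℝ (Fin n) :=
    LinearEquiv.ofInjectiveEndo (toEuclideanLin R) (injective_toEuclideanLin hR) with he
  set V : Submodule ℝ (EuclideanSpace ℝ (Fin n)) := ((faceSubmodule Hm H0)ᗮ).comap (e : _ →ₗ[ℝ] _) with hV
  have hfin : finrank ℝ V = n - finrank ℝ (faceSubmodule Hm H0) := by
    rw [hV, Submodule.comap_equiv_eq_map_symm, LinearEquiv.finrank_map_eq]
    have h := Submodule.finrank_add_finrank_orthogonal (faceSubmodule Hm H0)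
    rw [finrank_euclideanSpace_fin] at h
    omega
  have hform : ∀ x ∈ V, c * ‖x‖ ^ 2 ≤ RCLike.re ⟪x, toEuclideanLin (precond Hm H0 Hp R μ) x⟫_ℝ := by
    intro x hx
    have hRx : ∀ w ∈ faceSpace Hm H0, (R *ᵥ ofLp x) ⬝ᵥ w = 0 := by
      intro w hw
      have hex : e x ∈ (faceSubmodule Hm H0)ᗮ := hx
      have := dotProduct_eq_zero_of_mem_orthogonal hex w hw
      simpa [he] using this
    obtain ⟨ha, hb⟩ := re_inner_precond (H0 := H0) (Hp := Hp) hR x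
    rw [ha, hb]
    exact h2 _ hRx
  have hcount := finrank_le_card_le_eigenvalues (isHermitian_precond hm h0 hp R hμ) V hform
  rwa [hfin] at hcount

end Counting

/-! ### Packaged: the spectrum of the preconditioned three-scale pencil -/

section Spectrum

variable {Hm H0 Hp : Matrix (Fin n) (Fin n) ℝ}

/-- `dim T_F ≤ n`. [folklore] -/
theorem finrank_faceSubmodule_le (Hm H0 : Matrix (Fin n) (Fin n) ℝ) : finrank ℝ (faceSubmodule Hm H0) ≤ n := by
  have h := Submodule.finrank_le (faceSubmodule Hm H0)
  rwa [finrank_euclideanSpace_fin] at h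

/-- **The spectrum of the preconditioned three-scale pencil** (Courant–Fischer reading of `threeScalePencil_holds`):
for PSD `H₋, H₀, H₊` and `σ, μ₀ > 0` there are `μ`-free `c, C > 0`, `C₃ ≥ 0` such that for every `μ ∈ (0, μ₀]` and
every `R` with `Rᴴ P(μ) R = 1`, the eigenvalues `λᵢ` of `K = Rᴴ H(μ) R` satisfy: all `λᵢ ≤ C`; at least
`n − dim T_F` of them are `≥ c`; at least `dim T_F` of them are `≤ C₃ μ / σ`. [folklore] -/
theorem threeScalePencil_spectrum (hm : Hm.PosSemidef) (h0 : H0.PosSemidef) (hp : Hp.PosSemidef)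
    {σ μ₀ : ℝ} (hσ : 0 < σ) (hμ₀ : 0 < μ₀) :
    ∃ c C C₃ : ℝ, 0 < c ∧ 0 < C ∧ 0 ≤ C₃ ∧ ∀ (μ : ℝ) (hμ : 0 < μ), μ ≤ μ₀ →
      ∀ R : Matrix (Fin n) (Fin n) ℝ, Rᴴ * Pmu Hm σ μ * R = 1 →
        (∀ i, (isHermitian_precond hm h0 hp R hμ).eigenvalues i ≤ C) ∧
        n - finrank ℝ (faceSubmodule Hm H0) ≤
          (univ.filter fun j => c ≤ (isHermitian_precond hm h0 hp R hμ).eigenvalues j).card ∧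
        finrank ℝ (faceSubmodule Hm H0) ≤
          (univ.filter fun j => (isHermitian_precond hm h0 hp R hμ).eigenvalues j ≤ C₃ * μ / σ).card := by
  obtain ⟨c, C, C₃, hc, hC, hC₃, hall⟩ := threeScalePencil_holds n Hm H0 Hp hm h0 hp σ μ₀ hσ hμ₀
  refine ⟨c, C, C₃, hc, hC, hC₃, fun μ hμ hμle R hR => ?_⟩
  obtain ⟨h1, h2, h3⟩ := hall μ hμ hμle
  exact ⟨eigenvalues_precond_le hm h0 hp hμ hR h1,
    sub_finrank_faceSubmodule_le_card_le_eigenvalues hm h0 hp hμ hR h2,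
    finrank_faceSubmodule_le_card_eigenvalues_le hm h0 hp hσ hμ hR h3 hC₃⟩

/-- **Exact split for small `μ`.** With `c, C₃` as in the clauses and `C₃ μ / σ < c`, the preconditioned matrix has
EXACTLY `dim T_F` eigenvalues `≤ C₃μ/σ` and EXACTLY `n − dim T_F` eigenvalues `≥ c` (the two groups are disjoint and
their sizes are at least `dim T_F` and `n − dim T_F`). [folklore] -/
theorem threeScalePencil_spectrum_exact (hm : Hm.PosSemidef) (h0 : H0.PosSemidef) (hp : Hp.PosSemidef)
    {σ μ : ℝ} (hσ : 0 < σ) (hμ : 0 < μ) {R : Matrix (Fin n) (Fin n) ℝ} (hR : Rᴴ * Pmu Hm σ μ * R = 1)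
    {c C₃ : ℝ} (hC₃ : 0 ≤ C₃) (hsep : C₃ * μ / σ < c)
    (h2 : ∀ v, (∀ w ∈ faceSpace Hm H0, v ⬝ᵥ w = 0) → c * qf (Pmu Hm σ μ) v ≤ qf (Hmu Hm H0 Hp μ) v)
    (h3 : ∀ v ∈ faceSpace Hm H0, qf (Hmu Hm H0 Hp μ) v ≤ C₃ * μ * (v ⬝ᵥ v)) :
    (univ.filter fun j => (isHermitian_precond hm h0 hp R hμ).eigenvalues j ≤ C₃ * μ / σ).card =
        finrank ℝ (faceSubmodule Hm H0) ∧
      (univ.filter fun j => c ≤ (isHermitian_precond hm h0 hp R hμ).eigenvalues j).card =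
        n - finrank ℝ (faceSubmodule Hm H0) := by
  set A := univ.filter fun j => (isHermitian_precond hm h0 hp R hμ).eigenvalues j ≤ C₃ * μ / σ with hA
  set B := univ.filter fun j => c ≤ (isHermitian_precond hm h0 hp R hμ).eigenvalues j with hB
  have hlow := finrank_faceSubmodule_le_card_eigenvalues_le hm h0 hp hσ hμ hR h3 hC₃
  have hhigh := sub_finrank_faceSubmodule_le_card_le_eigenvalues hm h0 hp hμ hR h2
  have hk := finrank_faceSubmodule_le Hm H0
  have hdisj : Disjoint A B := by
    rw [Finset.disjoint_left]
    intro j hjA hjB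
    have h1 := (mem_filter.mp hjA).2
    have h2 := (mem_filter.mp hjB).2
    linarith
  have hunion : A.card + B.card ≤ n := by
    rw [← card_union_of_disjoint hdisj]
    exact (card_le_univ _).trans (by simp)
  rw [← hA] at hlow
  rw [← hB] at hhigh
  omega

end Spectrum

end Summit.Ventures.CertifiedManyBodySolver.HubbardAlg.KryIpm
end
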